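import Literature.Topology.FourManifolds.ChartMoves
import Literature.Topology.FourManifolds.WhitneyEmbeddingDimension
import HarnessLib

/-!
# Whitney's easy embedding theorem in a homotopy class: maps `Mᵏ → X`, `2k < dim X`

Topic `Literature/Topology/FourManifolds` (infrastructure for the fact seat of
`Literature.Topology.FourManifolds.HomotopySphere.exists_highlyConnected_of_mem_signatureSet`,
brick B8-E₃: the embedding step of Kosinski X.(2.1) — "by II.(3.2) every element of `πₖ(M)`,
`2k < m`, is represented by an imbedded sphere").  H. Whitney, *Differentiable manifolds*, Ann. of
Math. 37 (1936), §II Thm. 5; M. W. Hirsch, *Differential Topology* (1976), Ch. 2 §2 Thm. 2.13 with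
Ch. 3 §2 Thm. 2.5; J. Milnor, *Lectures on the h-cobordism theorem* (1965), Lemma 6.12; A. Kosinski,
*Differential Manifolds* (1993), II (3.2), IV (2.4): **a smooth map of a compact `k`-manifold into
a manifold `X` with `2k < dim X` is homotopic to an injective immersion** (an embedding, `M` being
compact).

## The proof formalised here

Chart by chart in the TARGET (the chart moves of `ChartMoves.lean`), with the generic linear
displacement `P_Λ x = Σᵢ J(x)ᵢ Λᵢ`, `Λ ∈ E^{q+1}`, where `J = (1, j) : M → ℝ^{q+1}` for a fixed
injective immersion `j : M → ℝ^q` (the tree's weak Whitney theorem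
`exists_injective_immersion_euclidean`).  For a move `x ↦ χ(ψ(g x) + β x • P_Λ x)` in a full chart:

* two moved points `x ≠ y` not both left fixed collide only if `Λ` solves the `n = dim X` linear
  equations `Σᵢ wᵢ Λᵢ = ψ(g y) - ψ(g x)`, `w = β x J x - β y J y ≠ 0` — an affine subspace of
  codimension `n`, so all such `Λ` form a set of Hausdorff dimension `≤ 2k + qn` (image of the
  `(2k + qn)`-manifold of pairs and free columns under a `C^∞` map; the tree's
  `dimH_image_le_finrank_of_contMDiffOn`, Hirsch Ch. 3 §1 Prop. 1.2);
* the differential of the moved map at a point `x` with `β x ≠ 0` kills a chart direction `w' ≠ 0`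
  only if `Σᵢ vᵢ Λᵢ = -D(ψ ∘ g)w'` with `v = (Dβ w') J x + β x (DJ w') ≠ 0` (`j` is an immersion)
  — again codimension `n`, Hausdorff dimension `≤ 2k + qn`;
* `2k < n` makes the union of the two bad sets of dimension `< (q+1) n = dim E^{q+1}`, so its
  complement is dense (`dense_compl_of_dimH_lt_finrank`) and meets the open neighbourhood of `0` of
  displacements keeping the finitely many chart constraints;
* for such `Λ` the property "injective differential at, and separation of, the points of `B`" is
  inherited by the move on `B ∪ {β ≠ 0}` with NO stability estimate: new collisions or kernel
  vectors only occur where `β = 0` (and `dβ = 0`, `β ≥ 0` having a minimum), where the move is the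
  old map to first order.

Finitely many moves over a cover of `M` by `{βᵢ ≠ 0}` give `exists_injective_immersion_homotopic`
(smooth `f`) and, with the smoothing of `ChartMoves.lean`, `exists_injective_immersion_homotopic_of_continuous`.

Everything is proved; no named facts are introduced (two auxiliary `def`s: the chart-read
derivative `chartReadDeriv` and the column insertion `insertCLM`).

## References

* H. Whitney, *Differentiable manifolds*, Ann. of Math. (2) 37 (1936), 645–680, §II Thm. 5.
  [Whitney1936]
* M. W. Hirsch, *Differential Topology*, GTM 33 (1976), Ch. 2 §2 Thm. 2.13, Ch. 3 §2 Thm. 2.5,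
  Ch. 3 §1 Prop. 1.2. [HirschDT1976]
* J. Milnor, *Lectures on the h-cobordism theorem* (1965), Lemma 6.12. [MilnorHCobordism1965]
* A. Kosinski, *Differential Manifolds* (1993), II (3.2), IV (2.4), X (2.1). [Kosinski1993]
-/

open scoped Manifold ContDiff Topology
open Set Function Metric Filter Module

noncomputable section

namespace Literature.Topology.FourManifolds

/-! ### Chart-read derivatives on a manifold modelled on `ℝᵏ` -/

section ChartDeriv

variable {k : ℕ} {M : Type*} [TopologicalSpace M] [ChartedSpace (EuclideanSpace ℝ (Fin k)) M]
  {F : Type*} [NormedAddCommGroup F] [NormedSpace ℝ F]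

/-- **The derivative of `f : M → F` read in the chart of `M` at `p`**: the derivative of the chart
representative `f ∘ φₚ⁻¹` at `φₚ x`, applied to `w`. [folklore] -/
def chartReadDeriv (f : M → F) (p x : M) (w : EuclideanSpace ℝ (Fin k)) : F :=
  fderivWithin ℝ (f ∘ (chartAt (EuclideanSpace ℝ (Fin k)) p).symm)
    (chartAt (EuclideanSpace ℝ (Fin k)) p).target (chartAt (EuclideanSpace ℝ (Fin k)) p x) w

variable [IsManifold (𝓡 k) ∞ M]

/-- The chart representative of a `C¹` map is differentiable at the chart image of a point of the
chart domain, with derivative the chart-read derivative. [folklore] -/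
theorem hasFDerivAt_comp_chart_symm {f : M → F} (hf : ContMDiff (𝓡 k) 𝓘(ℝ, F) 1 f) (p : M) {x : M}
    (hx : x ∈ (chartAt (EuclideanSpace ℝ (Fin k)) p).source) :
    HasFDerivAt (f ∘ (chartAt (EuclideanSpace ℝ (Fin k)) p).symm)
      (fderivWithin ℝ (f ∘ (chartAt (EuclideanSpace ℝ (Fin k)) p).symm)
        (chartAt (EuclideanSpace ℝ (Fin k)) p).target (chartAt (EuclideanSpace ℝ (Fin k)) p x))
      (chartAt (EuclideanSpace ℝ (Fin k)) p x) := by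
  set φ := chartAt (EuclideanSpace ℝ (Fin k)) p
  have hφx : φ x ∈ φ.target := φ.map_source hx
  have h1 : ContMDiffOn (𝓡 k) 𝓘(ℝ, F) 1 (f ∘ φ.symm) φ.target :=
    hf.comp_contMDiffOn contMDiffOn_chart_symm
  have h2 : ContDiffOn ℝ 1 (f ∘ φ.symm) φ.target := contMDiffOn_iff_contDiffOn.mp h1
  have h3 : DifferentiableAt ℝ (f ∘ φ.symm) (φ x) :=
    (h2.differentiableOn one_ne_zero).differentiableAt (φ.open_target.mem_nhds hφx)
  rw [fderivWithin_of_isOpen φ.open_target hφx]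
  exact h3.hasFDerivAt

/-- **Chart-read derivatives are values of the differential**: for `C¹` `f` and `x` in the chart
domain at `p`, `chartReadDeriv f p x w = df_x (d(φₚ⁻¹) w)`. [folklore] -/
theorem chartReadDeriv_eq_mfderiv {f : M → F} (hf : ContMDiff (𝓡 k) 𝓘(ℝ, F) 1 f) (p : M) {x : M}
    (hx : x ∈ (chartAt (EuclideanSpace ℝ (Fin k)) p).source) (w : EuclideanSpace ℝ (Fin k)) :
    chartReadDeriv f p x w = mfderiv (𝓡 k) 𝓘(ℝ, F) f x
      (mfderiv (𝓡 k) (𝓡 k) (chartAt (EuclideanSpace ℝ (Fin k)) p).symm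
        (chartAt (EuclideanSpace ℝ (Fin k)) p x) w) := by
  set φ := chartAt (EuclideanSpace ℝ (Fin k)) p
  have hφx : φ x ∈ φ.target := φ.map_source hx
  have hd : φ.symm.MDifferentiable (𝓡 k) (𝓡 k) := (mdifferentiable_chart p).symm
  have hfd : MDifferentiableAt (𝓡 k) 𝓘(ℝ, F) f x := hf.mdifferentiableAt one_ne_zero
  have hsd : MDifferentiableAt (𝓡 k) (𝓡 k) φ.symm (φ x) :=
    hd.mdifferentiableAt (by simpa using hφx)
  have key : mfderiv (𝓡 k) 𝓘(ℝ, F) (f ∘ φ.symm) (φ x) w =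
      mfderiv (𝓡 k) 𝓘(ℝ, F) f x (mfderiv (𝓡 k) (𝓡 k) φ.symm (φ x) w) := by
    rw [mfderiv_comp_apply_of_eq (φ x) hfd hsd (φ.left_inv hx)]
  unfold chartReadDeriv
  rw [fderivWithin_of_isOpen φ.open_target hφx, ← mfderiv_eq_fderiv]
  exact key

/-- The differential of the inverse chart at a chart image is onto. [folklore] -/
theorem surjective_mfderiv_chart_symm (p : M) {x : M}
    (hx : x ∈ (chartAt (EuclideanSpace ℝ (Fin k)) p).source) :
    Surjective (mfderiv (𝓡 k) (𝓡 k) (chartAt (EuclideanSpace ℝ (Fin k)) p).symm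
      (chartAt (EuclideanSpace ℝ (Fin k)) p x)) := by
  set φ := chartAt (EuclideanSpace ℝ (Fin k)) p
  have hφx : φ x ∈ φ.target := φ.map_source hx
  exact (mdifferentiable_chart p).symm.mfderiv_surjective (by simpa using hφx)

/-- The differential of the inverse chart at a chart image is injective. [folklore] -/
theorem injective_mfderiv_chart_symm (p : M) {x : M}
    (hx : x ∈ (chartAt (EuclideanSpace ℝ (Fin k)) p).source) :
    Injective (mfderiv (𝓡 k) (𝓡 k) (chartAt (EuclideanSpace ℝ (Fin k)) p).symm
      (chartAt (EuclideanSpace ℝ (Fin k)) p x)) := by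
  set φ := chartAt (EuclideanSpace ℝ (Fin k)) p
  have hφx : φ x ∈ φ.target := φ.map_source hx
  exact (mdifferentiable_chart p).symm.mfderiv_injective (by simpa using hφx)

/-- **Immersion at a point, read in a chart**: `df_x` is injective iff the chart-read derivative
`w ↦ chartReadDeriv f p x w` is. [folklore] -/
theorem injective_mfderiv_iff_chartDeriv {f : M → F} (hf : ContMDiff (𝓡 k) 𝓘(ℝ, F) 1 f) (p : M)
    {x : M} (hx : x ∈ (chartAt (EuclideanSpace ℝ (Fin k)) p).source) :
    Injective (mfderiv (𝓡 k) 𝓘(ℝ, F) f x) ↔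
      Injective fun w : EuclideanSpace ℝ (Fin k) => chartReadDeriv f p x w := by
  have hform : (fun w : EuclideanSpace ℝ (Fin k) => chartReadDeriv f p x w) = mfderiv (𝓡 k) 𝓘(ℝ, F) f x ∘
      mfderiv (𝓡 k) (𝓡 k) (chartAt (EuclideanSpace ℝ (Fin k)) p).symm
        (chartAt (EuclideanSpace ℝ (Fin k)) p x) := funext fun w => chartReadDeriv_eq_mfderiv hf p hx w
  rw [hform]
  constructor
  · exact fun h => h.comp (injective_mfderiv_chart_symm p hx)
  · exact fun h => Injective.of_comp_right h (surjective_mfderiv_chart_symm p hx)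

/-- Two `C¹` maps into a normed space with the same chart-read derivatives at `x` have the same
differential at `x`. [folklore] -/
theorem mfderiv_eq_of_chartDeriv_eq {f g : M → F} (hf : ContMDiff (𝓡 k) 𝓘(ℝ, F) 1 f)
    (hg : ContMDiff (𝓡 k) 𝓘(ℝ, F) 1 g) (p : M) {x : M}
    (hx : x ∈ (chartAt (EuclideanSpace ℝ (Fin k)) p).source)
    (h : ∀ w : EuclideanSpace ℝ (Fin k), chartReadDeriv f p x w = chartReadDeriv g p x w) :
    mfderiv (𝓡 k) 𝓘(ℝ, F) f x = mfderiv (𝓡 k) 𝓘(ℝ, F) g x := by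
  ext v
  obtain ⟨w, rfl⟩ := surjective_mfderiv_chart_symm p hx v
  exact (chartReadDeriv_eq_mfderiv hf p hx w).symm.trans
    ((h w).trans (chartReadDeriv_eq_mfderiv hg p hx w))

omit [IsManifold (𝓡 k) ∞ M] in
/-- A real function with a minimum at `x` has vanishing chart-read derivative there (Fermat; no
differentiability needed, the junk derivative being `0`). [folklore] -/
theorem chartReadDeriv_eq_zero_of_isMinOn {β : M → ℝ} (p : M) {x : M}
    (hx : x ∈ (chartAt (EuclideanSpace ℝ (Fin k)) p).source) (hmin : ∀ y, β x ≤ β y)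
    (w : EuclideanSpace ℝ (Fin k)) : chartReadDeriv β p x w = 0 := by
  set φ := chartAt (EuclideanSpace ℝ (Fin k)) p
  have hφx : φ x ∈ φ.target := φ.map_source hx
  have hloc : IsLocalMin (β ∘ φ.symm) (φ x) := by
    refine Filter.Eventually.of_forall fun e => ?_
    show β (φ.symm (φ x)) ≤ β (φ.symm e)
    rw [φ.left_inv hx]
    exact hmin _
  have h0 : fderiv ℝ (β ∘ φ.symm) (φ x) = 0 := hloc.fderiv_eq_zero
  unfold chartReadDeriv
  rw [fderivWithin_of_isOpen φ.open_target hφx, h0]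
  rfl

end ChartDeriv

/-! ### Column insertion and the dimension of the parameter space -/

section Insert

variable {E : Type*} [NormedAddCommGroup E] [NormedSpace ℝ E] [FiniteDimensional ℝ E] {q : ℕ}

/-- **Inserting a column**: `(e, Λ') ↦ Fin.insertNth i e Λ'`, a continuous linear map
`E × Eᵠ → E^{q+1}`. [folklore] -/
def insertCLM (i : Fin (q + 1)) : E × (Fin q → E) →L[ℝ] (Fin (q + 1) → E) :=
  LinearMap.toContinuousLinearMap
    { toFun := fun p => Fin.insertNth (α := fun _ => E) i p.1 p.2
      map_add' := fun p p' => by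
        show Fin.insertNth (α := fun _ => E) i (p.1 + p'.1) (p.2 + p'.2) = _
        rw [Fin.insertNth_add]
      map_smul' := fun a p => by
        funext l
        refine Fin.succAboveCases i ?_ (fun j => ?_) l
        · simp [Fin.insertNth_apply_same]
        · simp [Fin.insertNth_apply_succAbove] }

/-- Values of `insertCLM`. [folklore] -/
@[simp] theorem insertCLM_apply (i : Fin (q + 1)) (e : E) (Λ' : Fin q → E) :
    insertCLM i (e, Λ') = Fin.insertNth (α := fun _ => E) i e Λ' := rfl

/-- Re-inserting the `i`-th entry of `Λ` into the others gives `Λ` back. [folklore] -/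
theorem insertCLM_self (i : Fin (q + 1)) (Λ : Fin (q + 1) → E) :
    insertCLM i (Λ i, fun j => Λ (i.succAbove j)) = Λ := by
  rw [insertCLM_apply]
  exact Fin.insertNth_self_removeNth i Λ

/-- `dim E^q = q · dim E`. [folklore] -/
theorem finrank_fin_fun (q : ℕ) : finrank ℝ (Fin q → E) = q * finrank ℝ E := by
  rw [Module.finrank_pi_fintype, Finset.sum_const, Finset.card_univ, Fintype.card_fin, smul_eq_mul]

omit [FiniteDimensional ℝ E] in
/-- Splitting a sum over `Fin (q+1)` at `i`: `Σₗ wₗ • Λₗ = wᵢ • Λᵢ + Σⱼ w_{i.succAbove j} • Λ_{i.succAbove j}`.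
[folklore] -/
theorem sum_smul_eq_add_sum_succAbove (i : Fin (q + 1)) (w : Fin (q + 1) → ℝ)
    (Λ : Fin (q + 1) → E) :
    ∑ l, w l • Λ l = w i • Λ i + ∑ j, w (i.succAbove j) • Λ (i.succAbove j) :=
  Fin.sum_univ_succAbove (fun l => w l • Λ l) i

/-- **Solving for the `i`-th column.** If `Σₗ wₗ • Λₗ = c` with `wᵢ ≠ 0` then `Λ` is the
insertion, at `i`, of `wᵢ⁻¹ • (c - Σⱼ w_{i.succAbove j} • Λ'ⱼ)` into `Λ' = (Λ_{i.succAbove j})ⱼ`.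
[folklore] -/
theorem eq_insertCLM_of_sum_smul_eq {i : Fin (q + 1)} {w : Fin (q + 1) → ℝ}
    {Λ : Fin (q + 1) → E} {c : E} (h : ∑ l, w l • Λ l = c) (hi : w i ≠ 0) :
    Λ = insertCLM i
      ((w i)⁻¹ • (c - ∑ j, w (i.succAbove j) • Λ (i.succAbove j)), fun j => Λ (i.succAbove j)) := by
  have hΛi : Λ i = (w i)⁻¹ • (c - ∑ j, w (i.succAbove j) • Λ (i.succAbove j)) := by
    rw [sum_smul_eq_add_sum_succAbove i] at h
    rw [← h, add_sub_cancel_right, smul_smul, inv_mul_cancel₀ hi, one_smul]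
  conv_lhs => rw [← insertCLM_self i Λ]
  rw [hΛi]

end Insert

/-! ### The generic linear displacement -/

section Displacement

variable {E : Type*} [NormedAddCommGroup E] [InnerProductSpace ℝ E] [FiniteDimensional ℝ E]
  {k : ℕ} {M : Type*} [TopologicalSpace M] [ChartedSpace (EuclideanSpace ℝ (Fin k)) M]
  {q : ℕ}

/-- The coefficient map `J = (1, j) : M → ℝ^{q+1}` of an auxiliary map `j : M → ℝ^q`.
[folklore] -/
def coeffJ (j : M → EuclideanSpace ℝ (Fin q)) (x : M) : Fin (q + 1) → ℝ :=
  Fin.cons 1 fun i => j x i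

omit [TopologicalSpace M] in
/-- The `0`-th coefficient is `1`. [folklore] -/
@[simp] theorem coeffJ_zero (j : M → EuclideanSpace ℝ (Fin q)) (x : M) : coeffJ j x 0 = 1 := rfl

omit [TopologicalSpace M] in
/-- The later coefficients are the coordinates of `j x`. [folklore] -/
@[simp] theorem coeffJ_succ (j : M → EuclideanSpace ℝ (Fin q)) (x : M) (i : Fin q) :
    coeffJ j x i.succ = j x i := by
  simp [coeffJ]

/-- **The linear displacement** `P_Λ x = Σᵢ J(x)ᵢ • Λᵢ` with columns `Λ ∈ E^{q+1}`. [folklore] -/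
def columnPert (j : M → EuclideanSpace ℝ (Fin q)) (Λ : Fin (q + 1) → E) (x : M) : E :=
  ∑ l, coeffJ j x l • Λ l

omit [TopologicalSpace M] in
/-- `s • J x = t • J y` forces `s = t`, and `x = y` if moreover `s ≠ 0` and `j` is injective (the
first coordinate of `J` is `1`). [folklore] -/
theorem eq_of_smul_coeffJ_eq {j : M → EuclideanSpace ℝ (Fin q)} (hj : Injective j) {x y : M}
    {s t : ℝ} (h : s • coeffJ j x = t • coeffJ j y) : s = t ∧ (s ≠ 0 → x = y) := by
  have h0 := congrFun h 0
  simp only [Pi.smul_apply, coeffJ_zero, smul_eq_mul, mul_one] at h0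
  refine ⟨h0, fun hs => hj ?_⟩
  ext i
  have hi := congrFun h i.succ
  simp only [Pi.smul_apply, coeffJ_succ, smul_eq_mul] at hi
  rw [← h0] at hi
  exact mul_left_cancel₀ hs hi

/-- The coordinates of `J` are `C^∞` if `j` is. [folklore] -/
theorem contMDiff_coeffJ {j : M → EuclideanSpace ℝ (Fin q)} (hj : ContMDiff (𝓡 k) (𝓡 q) ∞ j)
    (l : Fin (q + 1)) : ContMDiff (𝓡 k) 𝓘(ℝ) ∞ fun x => coeffJ j x l := by
  refine Fin.cases ?_ (fun i => ?_) l
  · simp only [coeffJ_zero]; exact contMDiff_const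
  · simp only [coeffJ_succ]
    exact ((EuclideanSpace.proj i).contMDiff).comp hj

/-- The coefficient map is `C^∞` into `ℝ^{q+1}` if `j` is. [folklore] -/
theorem contMDiff_coeffJ' {j : M → EuclideanSpace ℝ (Fin q)} (hj : ContMDiff (𝓡 k) (𝓡 q) ∞ j) :
    ContMDiff (𝓡 k) 𝓘(ℝ, Fin (q + 1) → ℝ) ∞ (coeffJ j) :=
  contMDiff_pi_space.2 fun l => contMDiff_coeffJ hj l

omit [FiniteDimensional ℝ E] in
/-- The displacement is `C^∞` in the point. [folklore] -/
theorem contMDiff_columnPert [IsManifold (𝓡 k) ∞ M] {j : M → EuclideanSpace ℝ (Fin q)} (hj : ContMDiff (𝓡 k) (𝓡 q) ∞ j)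
    (Λ : Fin (q + 1) → E) : ContMDiff (𝓡 k) 𝓘(ℝ, E) ∞ (columnPert j Λ) := by
  unfold columnPert
  refine ContMDiff.sum fun l _ => ?_
  exact (contMDiff_coeffJ hj l).smul contMDiff_const

omit [FiniteDimensional ℝ E] in
/-- The displacement is continuous in the point if `j` is. [folklore] -/
theorem continuous_columnPert {j : M → EuclideanSpace ℝ (Fin q)} (hj : Continuous j)
    (Λ : Fin (q + 1) → E) : Continuous (columnPert j Λ) := by
  unfold columnPert
  refine continuous_finsetSum _ fun l _ => ?_
  refine Continuous.smul ?_ continuous_const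
  refine Fin.cases ?_ (fun i => ?_) l
  · simp only [coeffJ_zero]; exact continuous_const
  · simp only [coeffJ_succ]
    exact (EuclideanSpace.proj i).continuous.comp hj

/-- **The displacement as a continuous linear map `E^{q+1} → C(M, E)`** (linear in the columns;
continuous as the source is finite-dimensional). [folklore] -/
def columnPertCLM [CompactSpace M] {j : M → EuclideanSpace ℝ (Fin q)} (hj : Continuous j) :
    (Fin (q + 1) → E) →L[ℝ] C(M, E) :=
  LinearMap.toContinuousLinearMap
    { toFun := fun Λ => ⟨columnPert j Λ, continuous_columnPert hj Λ⟩
      map_add' := fun Λ Λ' => by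
        ext x
        simp only [ContinuousMap.coe_mk, ContinuousMap.add_apply, columnPert, Pi.add_apply, smul_add,
          Finset.sum_add_distrib]
      map_smul' := fun a Λ => by
        ext x
        simp only [ContinuousMap.coe_mk, ContinuousMap.smul_apply, columnPert, Pi.smul_apply,
          RingHom.id_apply, Finset.smul_sum, smul_comm a] }

/-- Evaluation of the displacement map. [folklore] -/
@[simp] theorem columnPertCLM_apply [CompactSpace M] {j : M → EuclideanSpace ℝ (Fin q)}
    (hj : Continuous j) (Λ : Fin (q + 1) → E) (x : M) : columnPertCLM hj Λ x = columnPert j Λ x := rfl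

end Displacement

/-! ### Collisions and kernel vectors of a moved map are controlled by linear equations -/

section Equations

variable {E : Type*} [NormedAddCommGroup E] [InnerProductSpace ℝ E] [FiniteDimensional ℝ E]
  {X : Type*} [TopologicalSpace X] [ChartedSpace E X]
  {k : ℕ} {M : Type*} [TopologicalSpace M] [ChartedSpace (EuclideanSpace ℝ (Fin k)) M]
  {q : ℕ}

omit [FiniteDimensional ℝ E] in
/-- **Collision equations.** If two distinct points collide under the move of `g` by the
displacement `P_Λ`, then either both are left fixed to first order (`β = 0` at both), or both
map into the coordinate domain, the coefficient vector `w = β x • J x - β y • J y` is nonzero and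
`Λ` solves `Σₗ wₗ • Λₗ = ψ (g y) - ψ (g x)`. [folklore] -/
theorem FullChart.move_columnPert_collision (c : FullChart E X) {g : M → X} {β : M → ℝ}
    (hsupp : tsupport β ⊆ g ⁻¹' c.1.source) {j : M → EuclideanSpace ℝ (Fin q)} (hj : Injective j)
    (Λ : Fin (q + 1) → E) {x y : M} (hxy : x ≠ y)
    (h : c.move g β (columnPert j Λ) x = c.move g β (columnPert j Λ) y) :
    (β x = 0 ∧ β y = 0) ∨
      (g x ∈ c.1.source ∧ g y ∈ c.1.source ∧ β x • coeffJ j x - β y • coeffJ j y ≠ 0 ∧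
        ∑ l, (β x • coeffJ j x - β y • coeffJ j y) l • Λ l = c.1 (g y) - c.1 (g x)) := by
  have hβ0 : ∀ z, g z ∉ c.1.source → β z = 0 := fun z hz => by
    by_contra h'
    exact hz (hsupp (subset_tsupport _ h'))
  by_cases hx : g x ∈ c.1.source
  · by_cases hy : g y ∈ c.1.source
    · rw [FullChart.move_of_mem hx, FullChart.move_of_mem hy] at h
      have h' := c.injective_symm h
      by_cases hw : β x • coeffJ j x - β y • coeffJ j y = 0
      · left
        obtain ⟨hst, hxy'⟩ := eq_of_smul_coeffJ_eq hj (sub_eq_zero.1 hw)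
        have hs : β x = 0 := by
          by_contra hs
          exact hxy (hxy' hs)
        exact ⟨hs, hst ▸ hs⟩
      · right
        refine ⟨hx, hy, hw, ?_⟩
        have : β x • columnPert j Λ x - β y • columnPert j Λ y = c.1 (g y) - c.1 (g x) := by
          rw [sub_eq_sub_iff_add_eq_add]
          exact (add_comm _ _).trans h'
        rw [← this]
        simp only [columnPert, Finset.smul_sum, ← Finset.sum_sub_distrib, Pi.sub_apply, Pi.smul_apply,
          smul_eq_mul, sub_smul, mul_smul]
    · exfalso
      have h1 : c.move g β (columnPert j Λ) x ∈ c.1.source := FullChart.move_mem hx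
      rw [h, FullChart.move_of_not_mem hy] at h1
      exact hy h1
  · by_cases hy : g y ∈ c.1.source
    · exfalso
      have h1 : c.move g β (columnPert j Λ) y ∈ c.1.source := FullChart.move_mem hy
      rw [← h, FullChart.move_of_not_mem hx] at h1
      exact hx h1
    · exact Or.inl ⟨hβ0 x hx, hβ0 y hy⟩

variable [IsManifold (𝓡 k) ∞ M]

omit [IsManifold (𝓡 k) ∞ M] in
/-- The chart-read derivative of a constant map vanishes. [folklore] -/
theorem chartReadDeriv_const {F : Type*} [NormedAddCommGroup F] [NormedSpace ℝ F] (a : F) (p x : M)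
    (w : EuclideanSpace ℝ (Fin k)) : chartReadDeriv (fun _ : M => a) p x w = 0 := by
  unfold chartReadDeriv
  have : ((fun _ : M => a) ∘ (chartAt (EuclideanSpace ℝ (Fin k)) p).symm) = fun _ => a := rfl
  rw [this, fderivWithin_const_apply]
  rfl

omit [IsManifold (𝓡 k) ∞ M] in
/-- The chart-read derivative is linear in the direction; in particular it vanishes at `0`.
[folklore] -/
theorem chartReadDeriv_zero {F : Type*} [NormedAddCommGroup F] [NormedSpace ℝ F] (f : M → F) (p x : M) :
    chartReadDeriv f p x (0 : EuclideanSpace ℝ (Fin k)) = 0 := by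
  unfold chartReadDeriv
  exact map_zero _

/-- **Coordinates of the chart-read derivative of a map into `ℝ^q`** are the chart-read
derivatives of its coordinates. [folklore] -/
theorem chartReadDeriv_apply_eq {j : M → EuclideanSpace ℝ (Fin q)}
    (hj : ContMDiff (𝓡 k) 𝓘(ℝ, EuclideanSpace ℝ (Fin q)) 1 j) (p : M) {x : M}
    (hx : x ∈ (chartAt (EuclideanSpace ℝ (Fin k)) p).source) (w' : EuclideanSpace ℝ (Fin k))
    (i : Fin q) : chartReadDeriv j p x w' i = chartReadDeriv (fun y => j y i) p x w' := by
  set φ := chartAt (EuclideanSpace ℝ (Fin k)) p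
  have hφx : φ x ∈ φ.target := φ.map_source hx
  have dj := hasFDerivAt_comp_chart_symm hj p hx
  have hfun : ((fun y => j y i) ∘ φ.symm) =
      (EuclideanSpace.proj i : EuclideanSpace ℝ (Fin q) →L[ℝ] ℝ) ∘ (j ∘ φ.symm) := by
    funext e
    simp
  have dji : HasFDerivAt ((fun y => j y i) ∘ φ.symm)
      ((EuclideanSpace.proj i : EuclideanSpace ℝ (Fin q) →L[ℝ] ℝ).comp
        (fderivWithin ℝ (j ∘ φ.symm) φ.target (φ x))) (φ x) := by
    rw [hfun]
    exact (EuclideanSpace.proj i).hasFDerivAt.comp (φ x) dj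
  have e : chartReadDeriv (fun y => j y i) p x w' =
      (fderivWithin ℝ (j ∘ φ.symm) φ.target (φ x) w') i := by
    unfold chartReadDeriv
    rw [fderivWithin_of_isOpen φ.open_target hφx, dji.fderiv]
    simp
  exact (show (fderivWithin ℝ (j ∘ φ.symm) φ.target (φ x) w') i = _ from e.symm)

omit [FiniteDimensional ℝ E] in
/-- **The chart-read derivative of the moved coordinate function.** For `m Λ = G + β • P_Λ`:
`D(m Λ) w' = DG w' + (Dβ w') • P_Λ x + β x • Σₗ (DJₗ w') • Λₗ`. [folklore] -/
theorem chartReadDeriv_add_smul_columnPert {G : M → E} (hG : ContMDiff (𝓡 k) 𝓘(ℝ, E) 1 G) {β : M → ℝ}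
    (hβ : ContMDiff (𝓡 k) 𝓘(ℝ) 1 β) {j : M → EuclideanSpace ℝ (Fin q)}
    (hj : ContMDiff (𝓡 k) (𝓡 q) ∞ j) (Λ : Fin (q + 1) → E) (p : M) {x : M}
    (hx : x ∈ (chartAt (EuclideanSpace ℝ (Fin k)) p).source) (w' : EuclideanSpace ℝ (Fin k)) :
    chartReadDeriv (fun y => G y + β y • columnPert j Λ y) p x w' =
      chartReadDeriv G p x w' + (chartReadDeriv β p x w' • columnPert j Λ x +
        β x • ∑ l, chartReadDeriv (fun y => coeffJ j y l) p x w' • Λ l) := by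
  set φ := chartAt (EuclideanSpace ℝ (Fin k)) p
  have hφx : φ x ∈ φ.target := φ.map_source hx
  have hJ1 : ∀ l, ContMDiff (𝓡 k) 𝓘(ℝ) 1 fun y => coeffJ j y l :=
    fun l => (contMDiff_coeffJ hj l).of_le (by exact_mod_cast le_top)
  -- derivatives of the chart representatives at `φ x`
  have dG := hasFDerivAt_comp_chart_symm hG p hx
  have dβ := hasFDerivAt_comp_chart_symm hβ p hx
  have dJ : ∀ l, HasFDerivAt ((fun y => coeffJ j y l) ∘ φ.symm)
      (fderivWithin ℝ ((fun y => coeffJ j y l) ∘ φ.symm) φ.target (φ x)) (φ x) :=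
    fun l => hasFDerivAt_comp_chart_symm (hJ1 l) p hx
  have dP : HasFDerivAt ((columnPert j Λ) ∘ φ.symm)
      (∑ l, (fderivWithin ℝ ((fun y => coeffJ j y l) ∘ φ.symm) φ.target (φ x)).smulRight (Λ l))
      (φ x) := by
    have : (columnPert j Λ) ∘ φ.symm = fun e => ∑ l, ((fun y => coeffJ j y l) ∘ φ.symm) e • Λ l := by
      funext e; simp [columnPert]
    rw [this]
    exact HasFDerivAt.fun_sum fun l _ => (dJ l).smul_const (Λ l)
  have dβP := dβ.smul dP
  have dm := dG.add dβP
  have e : chartReadDeriv (fun y => G y + β y • columnPert j Λ y) p x w' =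
      (fderivWithin ℝ (G ∘ φ.symm) φ.target (φ x) +
        ((β ∘ φ.symm) (φ x) •
            ∑ l, (fderivWithin ℝ ((fun y => coeffJ j y l) ∘ φ.symm) φ.target (φ x)).smulRight (Λ l) +
          (fderivWithin ℝ (β ∘ φ.symm) φ.target (φ x)).smulRight (((columnPert j Λ) ∘ φ.symm) (φ x))))
        w' := by
    unfold chartReadDeriv
    rw [fderivWithin_of_isOpen φ.open_target hφx]
    exact congrArg (fun L : EuclideanSpace ℝ (Fin k) →L[ℝ] E => L w') dm.fderiv
  rw [e]
  simp only [FunLike.coe_add, Pi.add_apply, FunLike.coe_smul, Pi.smul_apply, FunLike.coe_sum,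
    Finset.sum_apply, ContinuousLinearMap.smulRight_apply, comp_apply, φ.left_inv hx]
  show _ = fderivWithin ℝ (G ∘ φ.symm) φ.target (φ x) w' +
    (fderivWithin ℝ (β ∘ φ.symm) φ.target (φ x) w' • columnPert j Λ x +
      β x • ∑ l, fderivWithin ℝ ((fun y => coeffJ j y l) ∘ φ.symm) φ.target (φ x) w' • Λ l)
  abel

omit [FiniteDimensional ℝ E] in
/-- **Kernel equations.** If the chart-read derivative of `m Λ = G + β • P_Λ` at a point `x` with
`β x ≠ 0` kills a nonzero chart direction `w'`, then the coefficient vector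
`v = (Dβ w') • J x + β x • (DJ w')` is nonzero (because `j` is an immersion) and `Λ` solves
`Σₗ vₗ • Λₗ = -DG w'`. [folklore] -/
theorem chartReadDeriv_kernel {G : M → E} (hG : ContMDiff (𝓡 k) 𝓘(ℝ, E) 1 G) {β : M → ℝ}
    (hβ : ContMDiff (𝓡 k) 𝓘(ℝ) 1 β) {j : M → EuclideanSpace ℝ (Fin q)}
    (hj : ContMDiff (𝓡 k) (𝓡 q) ∞ j) (hj' : ∀ x, Injective (mfderiv (𝓡 k) (𝓡 q) j x))
    (Λ : Fin (q + 1) → E) (p : M) {x : M}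
    (hx : x ∈ (chartAt (EuclideanSpace ℝ (Fin k)) p).source) {w' : EuclideanSpace ℝ (Fin k)}
    (hβx : β x ≠ 0) (hw' : w' ≠ 0)
    (h0 : chartReadDeriv (fun y => G y + β y • columnPert j Λ y) p x w' = 0) :
    (chartReadDeriv β p x w' • coeffJ j x + β x • fun l => chartReadDeriv (fun y => coeffJ j y l) p x w') ≠ 0 ∧
      ∑ l, (chartReadDeriv β p x w' • coeffJ j x +
        β x • fun l => chartReadDeriv (fun y => coeffJ j y l) p x w') l • Λ l = -chartReadDeriv G p x w' := by
  have hj1 : ContMDiff (𝓡 k) 𝓘(ℝ, EuclideanSpace ℝ (Fin q)) 1 j := hj.of_le (by exact_mod_cast le_top)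
  constructor
  · intro hv
    -- coordinate `0`: `Dβ w' = 0`
    have h0' : chartReadDeriv β p x w' = 0 := by
      have := congrFun hv 0
      simp only [Pi.add_apply, Pi.smul_apply, coeffJ_zero, smul_eq_mul, mul_one, Pi.zero_apply] at this
      rwa [chartReadDeriv_const, mul_zero, add_zero] at this
    -- coordinates `succ i`: `β x • Djᵢ w' = 0`, so `Djᵢ w' = 0`
    have hji : ∀ i : Fin q, chartReadDeriv (fun y => j y i) p x w' = 0 := by
      intro i
      have hi := congrFun hv i.succ
      simp only [Pi.add_apply, Pi.smul_apply, h0', zero_smul, zero_add, smul_eq_mul, coeffJ_succ,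
        Pi.zero_apply, mul_eq_zero] at hi
      exact hi.resolve_left hβx
    -- hence `Dj w' = 0`, contradicting the immersion hypothesis
    have hzero : chartReadDeriv j p x w' = 0 := by
      ext i
      rw [chartReadDeriv_apply_eq hj1 p hx w' i, hji i]
      rfl
    have hinj := (injective_mfderiv_iff_chartDeriv (F := EuclideanSpace ℝ (Fin q)) hj1 p hx).1
      (hj' x)
    exact hw' (hinj (hzero.trans (chartReadDeriv_zero j p x).symm))
  · have h := chartReadDeriv_add_smul_columnPert hG hβ hj Λ p hx w'
    rw [h0] at h
    have e : ∑ l, (chartReadDeriv β p x w' • coeffJ j x +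
        β x • fun l => chartReadDeriv (fun y => coeffJ j y l) p x w') l • Λ l =
        chartReadDeriv β p x w' • columnPert j Λ x +
          β x • ∑ l, chartReadDeriv (fun y => coeffJ j y l) p x w' • Λ l := by
      simp only [Pi.add_apply, Pi.smul_apply, smul_eq_mul, add_smul, Finset.sum_add_distrib, columnPert,
        Finset.smul_sum, mul_smul]
    rw [e, eq_neg_iff_add_eq_zero, add_comm]
    exact h.symm

end Equations

/-! ### The bad columns have small Hausdorff dimension -/

section Dimension

variable {E : Type*} [NormedAddCommGroup E] [InnerProductSpace ℝ E] [FiniteDimensional ℝ E]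
  {X : Type*} [TopologicalSpace X] [ChartedSpace E X]
  {k : ℕ} {M : Type*} [TopologicalSpace M] [ChartedSpace (EuclideanSpace ℝ (Fin k)) M]
  [IsManifold (𝓡 k) ∞ M] [SecondCountableTopology M] {q : ℕ}

/-- **The solving map** `Φᵢ (w, c, Λ') = insert at i of wᵢ⁻¹ • (c - Σⱼ w_{i.succAbove j} • Λ'ⱼ)
into Λ'`: it is `C^∞` on `{wᵢ ≠ 0}`, and parametrises all solutions `Λ` of `Σₗ wₗ • Λₗ = c` with
`wᵢ ≠ 0` by their other columns. [folklore] -/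
theorem contDiffOn_solve (i : Fin (q + 1)) :
    ContDiffOn ℝ ∞ (fun z : (Fin (q + 1) → ℝ) × E × (Fin q → E) =>
      insertCLM i ((z.1 i)⁻¹ • (z.2.1 - ∑ j', z.1 (i.succAbove j') • z.2.2 j'), z.2.2))
      {z | z.1 i ≠ 0} := by
  refine ((insertCLM (E := E) i).contDiff.comp_contDiffOn ?_)
  refine ContDiffOn.prodMk ?_ (contDiff_snd.comp contDiff_snd).contDiffOn
  refine ContDiffOn.smul ?_ ?_
  · refine ContDiffOn.inv ?_ fun z hz => hz
    exact ((ContinuousLinearMap.proj i : (Fin (q + 1) → ℝ) →L[ℝ] ℝ).contDiff.comp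
      contDiff_fst).contDiffOn
  · refine ((contDiff_fst.comp contDiff_snd).sub ?_).contDiffOn
    refine ContDiff.sum fun j' _ => ?_
    exact ((ContinuousLinearMap.proj (i.succAbove j') : (Fin (q + 1) → ℝ) →L[ℝ] ℝ).contDiff.comp
      contDiff_fst).smul
      ((ContinuousLinearMap.proj j' : (Fin q → E) →L[ℝ] E).contDiff.comp
        (contDiff_snd.comp contDiff_snd))

omit [SecondCountableTopology M] in
/-- The chart-read derivative of a `C^∞` map is `C¹` jointly in the point (of the chart domain)
and the direction (the tree's `contMDiffOn_fderivWithin_comp_chartAt_symm`). [folklore] -/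
theorem contMDiffOn_chartDeriv {F : Type*} [NormedAddCommGroup F] [NormedSpace ℝ F] {f : M → F}
    (hf : ContMDiff (𝓡 k) 𝓘(ℝ, F) ∞ f) (p : M) :
    ContMDiffOn ((𝓡 k).prod (𝓡 k)) 𝓘(ℝ, F) 1
      (fun z : M × EuclideanSpace ℝ (Fin k) => chartReadDeriv f p z.1 z.2)
      ((chartAt (EuclideanSpace ℝ (Fin k)) p).source ×ˢ univ) :=
  contMDiffOn_fderivWithin_comp_chartAt_symm hf p

/-- **The collision columns are small.** The set of columns `Λ` for which some pair of points
`x, y` with `g x, g y` in the coordinate domain, nonzero coefficient vector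
`w = β x • J x - β y • J y`, satisfies `Σₗ wₗ • Λₗ = ψ (g y) - ψ (g x)`, has Hausdorff dimension at
most `2k + q · dim E` (Hirsch 1976, Ch. 3 §2, proof of Thm. 2.5: it is covered by the images of the
`(2k + q·dim E)`-manifolds `{wᵢ ≠ 0} ⊆ (M × M) × E^q` under `C^∞` maps).
[cite: HirschDT1976, Ch. 3 §2 Thm. 2.5] -/
theorem dimH_collisionColumns_le (c : FullChart E X) {g : M → X} (hg : ContMDiff (𝓡 k) 𝓘(ℝ, E) ∞ g)
    {β : M → ℝ} (hβ : ContMDiff (𝓡 k) 𝓘(ℝ) ∞ β) {j : M → EuclideanSpace ℝ (Fin q)}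
    (hj : ContMDiff (𝓡 k) (𝓡 q) ∞ j) :
    dimH {Λ : Fin (q + 1) → E | ∃ x y : M, g x ∈ c.1.source ∧ g y ∈ c.1.source ∧
      β x • coeffJ j x - β y • coeffJ j y ≠ 0 ∧
        ∑ l, (β x • coeffJ j x - β y • coeffJ j y) l • Λ l = c.1 (g y) - c.1 (g x)} ≤
      (k + k : ℕ) + q * finrank ℝ E := by
  -- the coefficient vector and the right-hand side as functions of the pair
  set w : M → M → Fin (q + 1) → ℝ := fun x y => β x • coeffJ j x - β y • coeffJ j y with hw
  set cc : M → M → E := fun x y => c.1 (g y) - c.1 (g x) with hcc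
  have hwc : ContMDiff ((𝓡 k).prod (𝓡 k)) 𝓘(ℝ, Fin (q + 1) → ℝ) ∞ fun z : M × M => w z.1 z.2 := by
    have h1 : ContMDiff (𝓡 k) 𝓘(ℝ, Fin (q + 1) → ℝ) ∞ fun x => β x • coeffJ j x :=
      hβ.smul (contMDiff_coeffJ' hj)
    exact (h1.comp contMDiff_fst).sub (h1.comp contMDiff_snd)
  set V : Set (M × M) := {z | g z.1 ∈ c.1.source ∧ g z.2 ∈ c.1.source} with hV
  have hVo : IsOpen V := ((c.1.open_source.preimage hg.continuous).preimage continuous_fst).inter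
    ((c.1.open_source.preimage hg.continuous).preimage continuous_snd)
  have hccV : ContMDiffOn ((𝓡 k).prod (𝓡 k)) 𝓘(ℝ, E) ∞ (fun z : M × M => cc z.1 z.2) V := by
    have h1 : ContMDiffOn (𝓡 k) 𝓘(ℝ, E) ∞ (fun x => c.1 (g x)) (g ⁻¹' c.1.source) :=
      c.2.contMDiffOn.comp hg.contMDiffOn fun x hx => hx
    exact (h1.comp contMDiff_snd.contMDiffOn fun z hz => hz.2).sub
      (h1.comp contMDiff_fst.contMDiffOn fun z hz => hz.1)
  -- the pieces
  set O : Fin (q + 1) → Set ((M × M) × (Fin q → E)) := fun i => {z | z.1 ∈ V ∧ w z.1.1 z.1.2 i ≠ 0}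
    with hO
  set F : Fin (q + 1) → (M × M) × (Fin q → E) → (Fin (q + 1) → E) := fun i z =>
    insertCLM i ((w z.1.1 z.1.2 i)⁻¹ • (cc z.1.1 z.1.2 - ∑ j', w z.1.1 z.1.2 (i.succAbove j') • z.2 j'),
      z.2) with hF
  have hOo : ∀ i, IsOpen (O i) := fun i => by
    refine (hVo.preimage continuous_fst).inter ?_
    have : Continuous fun z : (M × M) × (Fin q → E) => w z.1.1 z.1.2 i :=
      (continuous_apply i).comp (hwc.continuous.comp continuous_fst)
    exact isOpen_ne_fun this continuous_const
  have hFO : ∀ i, ContMDiffOn (((𝓡 k).prod (𝓡 k)).prod 𝓘(ℝ, Fin q → E))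
      𝓘(ℝ, Fin (q + 1) → E) 1 (F i) (O i) := by
    intro i
    -- `F i = Φᵢ ∘ Ψ` with `Ψ z = (w, cc, z.2)`
    have hΨ : ContMDiffOn (((𝓡 k).prod (𝓡 k)).prod 𝓘(ℝ, Fin q → E))
        𝓘(ℝ, (Fin (q + 1) → ℝ) × E × (Fin q → E)) ∞
        (fun z : (M × M) × (Fin q → E) => (w z.1.1 z.1.2, cc z.1.1 z.1.2, z.2)) {z | z.1 ∈ V} := by
      refine ContMDiffOn.prodMk_space ?_ (ContMDiffOn.prodMk_space ?_ contMDiff_snd.contMDiffOn)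
      · exact (hwc.comp contMDiff_fst).contMDiffOn
      · exact hccV.comp contMDiff_fst.contMDiffOn fun z hz => hz
    have hΦ := (contDiffOn_solve (E := E) i).contMDiffOn (n := ∞)
    have hcomp : ContMDiffOn (((𝓡 k).prod (𝓡 k)).prod 𝓘(ℝ, Fin q → E))
        𝓘(ℝ, Fin (q + 1) → E) ∞ (F i) (O i) :=
      hΦ.comp (hΨ.mono fun z (hz : z ∈ O i) => hz.1) fun z (hz : z ∈ O i) => hz.2
    exact hcomp.of_le (by exact_mod_cast le_top)
  -- covering
  have hsub : {Λ : Fin (q + 1) → E | ∃ x y : M, g x ∈ c.1.source ∧ g y ∈ c.1.source ∧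
      β x • coeffJ j x - β y • coeffJ j y ≠ 0 ∧
        ∑ l, (β x • coeffJ j x - β y • coeffJ j y) l • Λ l = c.1 (g y) - c.1 (g x)} ⊆
      ⋃ i, F i '' O i := by
    rintro Λ ⟨x, y, hx, hy, hw0, hsum⟩
    obtain ⟨i, hi⟩ := Function.ne_iff.1 hw0
    refine mem_iUnion.2 ⟨i, ⟨((x, y), fun j' => Λ (i.succAbove j')), ⟨⟨hx, hy⟩, hi⟩, ?_⟩⟩
    exact (eq_insertCLM_of_sum_smul_eq hsum hi).symm
  refine (dimH_mono hsub).trans ?_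
  rw [dimH_iUnion]
  refine iSup_le fun i => ?_
  refine (dimH_image_le_finrank_of_contMDiffOn (I := ((𝓡 k).prod (𝓡 k)).prod 𝓘(ℝ, Fin q → E))
    (hOo i) (hFO i)).trans ?_
  rw [finrank_prod, finrank_prod, finrank_euclideanSpace_fin, finrank_fin_fun]
  norm_cast

/-- **The kernel columns are small.** For a countable set `T` of chart centres, the set of columns
`Λ` for which some `p ∈ T`, `x` in the chart domain at `p` and chart direction `w'` with nonzero
coefficient vector `v = (Dβ w') • J x + β x • (DJ w')` satisfy `Σₗ vₗ • Λₗ = -DG w'` has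
Hausdorff dimension at most `2k + q · dim E` (covered by the images of the `(2k + q·dim E)`-
manifolds `{vᵢ ≠ 0} ⊆ (M × ℝᵏ) × E^q` under `C¹` maps; Hirsch Ch. 3 §2 Thm. 2.5).
[cite: HirschDT1976, Ch. 3 §2 Thm. 2.5] -/
theorem dimH_kernelColumns_le {G : M → E} (hG : ContMDiff (𝓡 k) 𝓘(ℝ, E) ∞ G) {β : M → ℝ}
    (hβ : ContMDiff (𝓡 k) 𝓘(ℝ) ∞ β) {j : M → EuclideanSpace ℝ (Fin q)}
    (hj : ContMDiff (𝓡 k) (𝓡 q) ∞ j) {T : Set M} (hT : T.Countable) :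
    dimH {Λ : Fin (q + 1) → E | ∃ p ∈ T, ∃ x ∈ (chartAt (EuclideanSpace ℝ (Fin k)) p).source,
      ∃ w' : EuclideanSpace ℝ (Fin k),
        (chartReadDeriv β p x w' • coeffJ j x +
          β x • fun l => chartReadDeriv (fun y => coeffJ j y l) p x w') ≠ 0 ∧
        ∑ l, (chartReadDeriv β p x w' • coeffJ j x +
          β x • fun l => chartReadDeriv (fun y => coeffJ j y l) p x w') l • Λ l = -chartReadDeriv G p x w'} ≤
      (k + k : ℕ) + q * finrank ℝ E := by
  -- the coefficient vector and the right-hand side as functions of `(x, w')`, chart at `p`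
  set v : M → M → EuclideanSpace ℝ (Fin k) → Fin (q + 1) → ℝ := fun p x w' =>
    chartReadDeriv β p x w' • coeffJ j x + β x • fun l => chartReadDeriv (fun y => coeffJ j y l) p x w'
    with hv
  have hvc : ∀ p, ContMDiffOn ((𝓡 k).prod (𝓡 k)) 𝓘(ℝ, Fin (q + 1) → ℝ) 1
      (fun z : M × EuclideanSpace ℝ (Fin k) => v p z.1 z.2)
      ((chartAt (EuclideanSpace ℝ (Fin k)) p).source ×ˢ univ) := by
    intro p
    have h1 := contMDiffOn_chartDeriv hβ p
    have h2 : ContMDiffOn ((𝓡 k).prod (𝓡 k)) 𝓘(ℝ, Fin (q + 1) → ℝ) 1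
        (fun z : M × EuclideanSpace ℝ (Fin k) => coeffJ j z.1)
        ((chartAt (EuclideanSpace ℝ (Fin k)) p).source ×ˢ univ) :=
      (((contMDiff_coeffJ' hj).of_le (by exact_mod_cast le_top)).comp contMDiff_fst).contMDiffOn
    have h3 : ContMDiffOn ((𝓡 k).prod (𝓡 k)) 𝓘(ℝ) 1 (fun z : M × EuclideanSpace ℝ (Fin k) => β z.1)
        ((chartAt (EuclideanSpace ℝ (Fin k)) p).source ×ˢ univ) :=
      ((hβ.of_le (by exact_mod_cast le_top)).comp contMDiff_fst).contMDiffOn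
    have h4 : ContMDiffOn ((𝓡 k).prod (𝓡 k)) 𝓘(ℝ, Fin (q + 1) → ℝ) 1
        (fun z : M × EuclideanSpace ℝ (Fin k) => fun l => chartReadDeriv (fun y => coeffJ j y l) p z.1 z.2)
        ((chartAt (EuclideanSpace ℝ (Fin k)) p).source ×ˢ univ) :=
      contMDiffOn_pi_space.2 fun l => contMDiffOn_chartDeriv (contMDiff_coeffJ hj l) p
    exact (h1.smul h2).add (h3.smul h4)
  have hGc : ∀ p, ContMDiffOn ((𝓡 k).prod (𝓡 k)) 𝓘(ℝ, E) 1
      (fun z : M × EuclideanSpace ℝ (Fin k) => -chartReadDeriv G p z.1 z.2)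
      ((chartAt (EuclideanSpace ℝ (Fin k)) p).source ×ˢ univ) := fun p => (contMDiffOn_chartDeriv hG p).neg
  -- the pieces
  set O : M → Fin (q + 1) → Set ((M × EuclideanSpace ℝ (Fin k)) × (Fin q → E)) := fun p i =>
    {z | z.1.1 ∈ (chartAt (EuclideanSpace ℝ (Fin k)) p).source ∧ v p z.1.1 z.1.2 i ≠ 0} with hO
  set F : M → Fin (q + 1) → (M × EuclideanSpace ℝ (Fin k)) × (Fin q → E) → (Fin (q + 1) → E) :=
    fun p i z => insertCLM i ((v p z.1.1 z.1.2 i)⁻¹ •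
      (-chartReadDeriv G p z.1.1 z.1.2 - ∑ j', v p z.1.1 z.1.2 (i.succAbove j') • z.2 j'), z.2) with hF
  have hOo : ∀ p i, IsOpen (O p i) := fun p i => by
    have hsrc : IsOpen {z : (M × EuclideanSpace ℝ (Fin k)) × (Fin q → E) |
        z.1.1 ∈ (chartAt (EuclideanSpace ℝ (Fin k)) p).source} :=
      ((chartAt (EuclideanSpace ℝ (Fin k)) p).open_source.preimage continuous_fst).preimage
        continuous_fst
    have hcont : ContinuousOn (fun z : (M × EuclideanSpace ℝ (Fin k)) × (Fin q → E) =>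
        v p z.1.1 z.1.2 i) {z | z.1.1 ∈ (chartAt (EuclideanSpace ℝ (Fin k)) p).source} :=
      ((continuous_apply i).comp_continuousOn ((hvc p).continuousOn)).comp
        continuous_fst.continuousOn fun z hz => ⟨hz, mem_univ _⟩
    exact hcont.isOpen_inter_preimage hsrc isOpen_ne
  have hFO : ∀ p i, ContMDiffOn (((𝓡 k).prod (𝓡 k)).prod 𝓘(ℝ, Fin q → E))
      𝓘(ℝ, Fin (q + 1) → E) 1 (F p i) (O p i) := by
    intro p i
    have hΨ : ContMDiffOn (((𝓡 k).prod (𝓡 k)).prod 𝓘(ℝ, Fin q → E))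
        𝓘(ℝ, (Fin (q + 1) → ℝ) × E × (Fin q → E)) 1
        (fun z : (M × EuclideanSpace ℝ (Fin k)) × (Fin q → E) =>
          (v p z.1.1 z.1.2, -chartReadDeriv G p z.1.1 z.1.2, z.2))
        {z | z.1.1 ∈ (chartAt (EuclideanSpace ℝ (Fin k)) p).source} := by
      refine ContMDiffOn.prodMk_space ?_ (ContMDiffOn.prodMk_space ?_ contMDiff_snd.contMDiffOn)
      · exact (hvc p).comp contMDiff_fst.contMDiffOn fun z hz => ⟨hz, mem_univ _⟩
      · exact (hGc p).comp contMDiff_fst.contMDiffOn fun z hz => ⟨hz, mem_univ _⟩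
    have hΦ := (contDiffOn_solve (E := E) i).contMDiffOn (n := ∞)
    exact (hΦ.of_le (by exact_mod_cast le_top)).comp (hΨ.mono fun z (hz : z ∈ O p i) => hz.1)
      fun z (hz : z ∈ O p i) => hz.2
  -- covering
  have hsub : {Λ : Fin (q + 1) → E | ∃ p ∈ T, ∃ x ∈ (chartAt (EuclideanSpace ℝ (Fin k)) p).source,
      ∃ w' : EuclideanSpace ℝ (Fin k),
        (chartReadDeriv β p x w' • coeffJ j x +
          β x • fun l => chartReadDeriv (fun y => coeffJ j y l) p x w') ≠ 0 ∧
        ∑ l, (chartReadDeriv β p x w' • coeffJ j x +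
          β x • fun l => chartReadDeriv (fun y => coeffJ j y l) p x w') l • Λ l = -chartReadDeriv G p x w'} ⊆
      ⋃ p ∈ T, ⋃ i, F p i '' O p i := by
    rintro Λ ⟨p, hp, x, hx, w', hv0, hsum⟩
    obtain ⟨i, hi⟩ := Function.ne_iff.1 hv0
    refine mem_iUnion₂.2 ⟨p, hp, mem_iUnion.2 ⟨i, ⟨((x, w'), fun j' => Λ (i.succAbove j')),
      ⟨hx, hi⟩, ?_⟩⟩⟩
    exact (eq_insertCLM_of_sum_smul_eq hsum hi).symm
  refine (dimH_mono hsub).trans ?_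
  rw [dimH_bUnion hT]
  refine iSup₂_le fun p _ => ?_
  rw [dimH_iUnion]
  refine iSup_le fun i => ?_
  refine (dimH_image_le_finrank_of_contMDiffOn (I := ((𝓡 k).prod (𝓡 k)).prod 𝓘(ℝ, Fin q → E))
    (hOo p i) (hFO p i)).trans ?_
  rw [finrank_prod, finrank_prod, finrank_euclideanSpace_fin, finrank_fin_fun]
  norm_cast

/-- **Generic small columns exist** when `2k < dim E`: off the collision columns and off the
kernel columns (both of Hausdorff dimension `≤ 2k + q·dim E < (q+1)·dim E`, so that their
complement is dense, `dense_compl_of_dimH_lt_finrank`) there are columns in any open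
neighbourhood of `0`. [cite: HirschDT1976, Ch. 3 §2 Thm. 2.5] -/
theorem exists_columns_notMem (hk : 2 * k < finrank ℝ E) {S₁ S₂ : Set (Fin (q + 1) → E)}
    (h₁ : dimH S₁ ≤ (k + k : ℕ) + q * finrank ℝ E) (h₂ : dimH S₂ ≤ (k + k : ℕ) + q * finrank ℝ E)
    {A : Set (Fin (q + 1) → E)} (hA : IsOpen A) (hA0 : A.Nonempty) :
    ∃ Λ ∈ A, Λ ∉ S₁ ∧ Λ ∉ S₂ := by
  have hdim : dimH (S₁ ∪ S₂) < finrank ℝ (Fin (q + 1) → E) := by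
    rw [dimH_union, finrank_fin_fun]
    have hlt : ((k + k : ℕ) : ENNReal) + (q * finrank ℝ E : ℕ) < ((q + 1) * finrank ℝ E : ℕ) := by
      have : (k + k) + q * finrank ℝ E < (q + 1) * finrank ℝ E := by nlinarith
      exact_mod_cast this
    have h₁' : dimH S₁ < ((q + 1) * finrank ℝ E : ℕ) := lt_of_le_of_lt (by exact_mod_cast h₁) hlt
    have h₂' : dimH S₂ < ((q + 1) * finrank ℝ E : ℕ) := lt_of_le_of_lt (by exact_mod_cast h₂) hlt
    exact max_lt h₁' h₂'
  obtain ⟨Λ, hΛS, hΛA⟩ := (dense_compl_of_dimH_lt_finrank hdim).exists_mem_open hA hA0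
  simp only [mem_compl_iff, mem_union, not_or] at hΛS
  exact ⟨Λ, hΛA, hΛS.1, hΛS.2⟩

end Dimension

/-! ### The generic move -/

section Step

variable {E : Type*} [NormedAddCommGroup E] [InnerProductSpace ℝ E] [FiniteDimensional ℝ E]
  {X : Type*} [TopologicalSpace X] [ChartedSpace E X]
  {k : ℕ} {M : Type*} [TopologicalSpace M] [ChartedSpace (EuclideanSpace ℝ (Fin k)) M]
  [IsManifold (𝓡 k) ∞ M] [SecondCountableTopology M] [CompactSpace M] [T2Space M]

/-- **The generic chart move (Whitney 1936, §II Thm. 5; Hirsch 1976, Ch. 3 §2 Thm. 2.5 — one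
chart of the target).**  Let `2k < dim E`, `g : M → X` smooth, `c` a full chart of `X`, `β ≥ 0` a
smooth weight with `tsupport β ⊆ g ⁻¹' U`, and suppose `g` has injective differential at, and
separates, the points of `B`.  Then some chart move `g'` of `g` (hence homotopic to it) is
smooth, has injective differential at and separates the points of `B ∪ {β ≠ 0}`, and still maps
finitely many given compact `C i` into open `V i`.  The displacement is `P_Λ` for columns `Λ`
off the collision and kernel columns (`dimH_collisionColumns_le`, `dimH_kernelColumns_le`,
`exists_columns_notMem`) and small enough for the constraints
(`FullChart.exists_pos_forall_mapsTo_move`). [cite: HirschDT1976, Ch. 3 §2 Thm. 2.5] -/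
theorem FullChart.exists_move_injImm (c : FullChart E X) (hk : 2 * k < finrank ℝ E) {g : M → X}
    (hg : ContMDiff (𝓡 k) 𝓘(ℝ, E) ∞ g) {β : M → ℝ} (hβ : ContMDiff (𝓡 k) 𝓘(ℝ) ∞ β)
    (hβ0 : ∀ x, 0 ≤ β x) (hsupp : tsupport β ⊆ g ⁻¹' c.1.source) {B : Set M}
    (hBi : ∀ b ∈ B, Injective (mfderiv (𝓡 k) 𝓘(ℝ, E) g b))
    (hBs : ∀ b ∈ B, ∀ y, g y = g b → y = b)
    {ι : Type*} [Finite ι] {C : ι → Set M} {V : ι → Set X} (hC : ∀ i, IsCompact (C i))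
    (hV : ∀ i, IsOpen (V i)) (hCV : ∀ i, MapsTo g (C i) (V i)) :
    ∃ P : C(M, E), ContMDiff (𝓡 k) 𝓘(ℝ, E) ∞ (c.move g β P) ∧
      (∀ b ∈ B ∪ {x | β x ≠ 0}, Injective (mfderiv (𝓡 k) 𝓘(ℝ, E) (c.move g β P) b)) ∧
      (∀ b ∈ B ∪ {x | β x ≠ 0}, ∀ y, c.move g β P y = c.move g β P b → y = b) ∧
      ∀ i, MapsTo (c.move g β P) (C i) (V i) := by
  have hWo : IsOpen (g ⁻¹' c.1.source) := c.1.open_source.preimage hg.continuous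
  -- ### the cut-off `β'` and the cut-off coordinate function `G`
  obtain ⟨L, hLc, hβL, hLW⟩ := exists_compact_between (isClosed_tsupport β).isCompact hWo hsupp
  obtain ⟨β', hβ'1, hβ'0, -⟩ := exists_contMDiffMap_one_nhds_of_subset_interior (𝓡 k)
    (isClosed_tsupport β) hβL (n := (⊤ : ℕ∞))
  have hβ's : tsupport β' ⊆ g ⁻¹' c.1.source := by
    refine (closure_minimal (fun x hx => ?_) hLc.isClosed).trans hLW
    by_contra h
    exact hx (hβ'0 x h)
  set G : M → E := fun x => β' x • c.1 (g x) with hGdef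
  have hG : ContMDiff (𝓡 k) 𝓘(ℝ, E) ∞ G := by
    have := contMDiffOn_cutoff_smul (IM := 𝓡 k) hWo isOpen_univ (F := fun x => c.1 (g x))
      (by rw [univ_inter]; exact c.2.contMDiffOn.comp hg.contMDiffOn fun x hx => hx)
      β'.contMDiff hβ's
    exact contMDiffOn_univ.1 this
  -- near `tsupport β` the cut-off coordinate function is the coordinate function
  have hGeq : ∀ x ∈ tsupport β, ∀ᶠ y in 𝓝 x, g y ∈ c.1.source ∧ G y = c.1 (g y) := by
    intro x hx
    have h1 : ∀ᶠ y in 𝓝 x, β' y = 1 := hβ'1.filter_mono (nhds_le_nhdsSet hx)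
    filter_upwards [h1, hWo.mem_nhds (hsupp hx)] with y hy hyU
    exact ⟨hyU, by simp only [hGdef, hy, one_smul]⟩
  -- ### the auxiliary injective immersion `j : M → ℝ^q` and the chart centres
  obtain ⟨j, hj, hjinj, hjimm⟩ :=
    exists_injective_immersion_euclidean (n := k) (M := M) (N := 2 * k + 1) le_rfl
  have hjc : Continuous j := hj.continuous
  obtain ⟨T, hTc, hTcov⟩ := TopologicalSpace.countable_cover_nhds
    (f := fun p : M => (chartAt (EuclideanSpace ℝ (Fin k)) p).source) fun p =>
      (chartAt (EuclideanSpace ℝ (Fin k)) p).open_source.mem_nhds (mem_chart_source _ p)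
  have hT : ∀ x : M, ∃ p ∈ T, x ∈ (chartAt (EuclideanSpace ℝ (Fin k)) p).source := fun x => by
    have : x ∈ ⋃ p ∈ T, (chartAt (EuclideanSpace ℝ (Fin k)) p).source := by
      rw [hTcov]; exact mem_univ x
    simpa only [mem_iUnion, exists_prop] using this
  -- ### generic small columns
  obtain ⟨δ, hδ, hδP⟩ := c.exists_pos_forall_mapsTo_move hg.continuous hβ.continuous hsupp hC hV hCV
  set A : Set (Fin (2 * k + 1 + 1) → E) := {Λ | ‖columnPertCLM (E := E) hjc Λ‖ < δ} with hA
  have hAo : IsOpen A := isOpen_lt (continuous_norm.comp (columnPertCLM hjc).continuous) continuous_const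
  have hA0 : (0 : Fin (2 * k + 1 + 1) → E) ∈ A := by
    show ‖columnPertCLM (E := E) hjc 0‖ < δ
    rw [map_zero, norm_zero]; exact hδ
  obtain ⟨Λ, hΛA, hΛ₁, hΛ₂⟩ := exists_columns_notMem hk (dimH_collisionColumns_le c hg hβ hj)
    (dimH_kernelColumns_le hG hβ hj hTc) hAo ⟨0, hA0⟩
  set P : C(M, E) := columnPertCLM hjc Λ with hPdef
  have hP : (P : M → E) = columnPert j Λ := funext fun x => rfl
  -- the moved coordinate function `m = G + β • P_Λ`
  set m : M → E := fun y => G y + β y • columnPert j Λ y with hmdef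
  have hm : ContMDiff (𝓡 k) 𝓘(ℝ, E) ∞ m := hG.add (hβ.smul (contMDiff_columnPert hj Λ))
  have hm1 : ContMDiff (𝓡 k) 𝓘(ℝ, E) 1 m := hm.of_le (by exact_mod_cast le_top)
  have hG1 : ContMDiff (𝓡 k) 𝓘(ℝ, E) 1 G := hG.of_le (by exact_mod_cast le_top)
  have hβ1 : ContMDiff (𝓡 k) 𝓘(ℝ) 1 β := hβ.of_le (by exact_mod_cast le_top)
  -- near `tsupport β` the move is `χ ∘ m` and `g` is `χ ∘ G`
  have hmove_eq : ∀ x ∈ tsupport β, (c.move g β P) =ᶠ[𝓝 x] fun y => c.1.symm (m y) := by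
    intro x hx
    filter_upwards [hGeq x hx] with y hy
    rw [FullChart.move_of_mem hy.1, hP]
    simp only [hmdef, hy.2]
  have hg_eq : ∀ x ∈ tsupport β, g =ᶠ[𝓝 x] fun y => c.1.symm (G y) := by
    intro x hx
    filter_upwards [hGeq x hx] with y hy
    rw [hy.2, c.1.left_inv hy.1]
  -- ### (K1) collisions only between unmoved points
  have K1 : ∀ x y, x ≠ y → c.move g β P x = c.move g β P y → β x = 0 ∧ β y = 0 := by
    intro x y hxy h
    rw [hP] at h
    rcases c.move_columnPert_collision hsupp hjinj Λ hxy h with h' | ⟨hx, hy, hw, hsum⟩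
    · exact h'
    · exact absurd ⟨x, y, hx, hy, hw, hsum⟩ hΛ₁
  have hχd : ∀ e : E, MDifferentiableAt 𝓘(ℝ, E) 𝓘(ℝ, E) c.1.symm e := fun e =>
    c.2.contMDiff_symm.mdifferentiableAt (by simp)
  have hmd : ∀ x, MDifferentiableAt (𝓡 k) 𝓘(ℝ, E) m x := fun x => hm1.mdifferentiableAt one_ne_zero
  have hGd : ∀ x, MDifferentiableAt (𝓡 k) 𝓘(ℝ, E) G x := fun x => hG1.mdifferentiableAt one_ne_zero
  -- ### (K3) where `β = 0` the differential is that of `g`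
  have K3 : ∀ x, β x = 0 → mfderiv (𝓡 k) 𝓘(ℝ, E) (c.move g β P) x = mfderiv (𝓡 k) 𝓘(ℝ, E) g x := by
    intro x hx
    by_cases hxs : x ∈ tsupport β
    · have e1 : mfderiv (𝓡 k) 𝓘(ℝ, E) (c.move g β P) x = mfderiv (𝓡 k) 𝓘(ℝ, E) (c.1.symm ∘ m) x :=
        (hmove_eq x hxs).mfderiv_eq
      have e2 : mfderiv (𝓡 k) 𝓘(ℝ, E) g x = mfderiv (𝓡 k) 𝓘(ℝ, E) (c.1.symm ∘ G) x :=
        (hg_eq x hxs).mfderiv_eq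
      have hmG : mfderiv (𝓡 k) 𝓘(ℝ, E) m x = mfderiv (𝓡 k) 𝓘(ℝ, E) G x := by
        refine mfderiv_eq_of_chartDeriv_eq hm1 hG1 x (mem_chart_source _ x) fun w => ?_
        rw [show m = fun y => G y + β y • columnPert j Λ y from rfl,
          chartReadDeriv_add_smul_columnPert hG1 hβ1 hj Λ x (mem_chart_source _ x) w,
          chartReadDeriv_eq_zero_of_isMinOn x (mem_chart_source _ x) (fun y => hx.symm ▸ hβ0 y) w,
          hx, zero_smul, zero_smul, add_zero, add_zero]
      have hmx : m x = G x := by simp only [hmdef, hx, zero_smul, add_zero]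
      ext v
      have s1 : (mfderiv (𝓡 k) 𝓘(ℝ, E) (c.move g β P) x v : E) =
          (mfderiv (𝓡 k) 𝓘(ℝ, E) (c.1.symm ∘ m) x v : E) := DFunLike.congr_fun e1 v
      have s2 : (mfderiv (𝓡 k) 𝓘(ℝ, E) (c.1.symm ∘ m) x v : E) =
          (mfderiv 𝓘(ℝ, E) 𝓘(ℝ, E) c.1.symm (G x) (mfderiv (𝓡 k) 𝓘(ℝ, E) m x v) : E) :=
        mfderiv_comp_apply_of_eq x (hχd (G x)) (hmd x) hmx v
      have s3 : (mfderiv 𝓘(ℝ, E) 𝓘(ℝ, E) c.1.symm (G x) (mfderiv (𝓡 k) 𝓘(ℝ, E) m x v) : E) =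
          (mfderiv 𝓘(ℝ, E) 𝓘(ℝ, E) c.1.symm (G x) (mfderiv (𝓡 k) 𝓘(ℝ, E) G x v) : E) :=
        congrArg (mfderiv 𝓘(ℝ, E) 𝓘(ℝ, E) c.1.symm (G x)) (DFunLike.congr_fun hmG v)
      have s4 : (mfderiv 𝓘(ℝ, E) 𝓘(ℝ, E) c.1.symm (G x) (mfderiv (𝓡 k) 𝓘(ℝ, E) G x v) : E) =
          (mfderiv (𝓡 k) 𝓘(ℝ, E) (c.1.symm ∘ G) x v : E) :=
        (mfderiv_comp_apply x (hχd (G x)) (hGd x) v).symm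
      have s5 : (mfderiv (𝓡 k) 𝓘(ℝ, E) (c.1.symm ∘ G) x v : E) = (mfderiv (𝓡 k) 𝓘(ℝ, E) g x v : E) :=
        DFunLike.congr_fun e2.symm v
      exact s1.trans (s2.trans (s3.trans (s4.trans s5)))
    · exact (FullChart.move_eventuallyEq_of_notMem_tsupport hxs _).mfderiv_eq
  -- ### (K2) where `β ≠ 0` the differential is injective
  have K2 : ∀ x, β x ≠ 0 → Injective (mfderiv (𝓡 k) 𝓘(ℝ, E) (c.move g β P) x) := by
    intro x hx
    have hxs : x ∈ tsupport β := subset_tsupport _ hx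
    -- the moved coordinate function has injective differential at `x`
    have hinjm : Injective (mfderiv (𝓡 k) 𝓘(ℝ, E) m x) := by
      obtain ⟨p, hp, hxp⟩ := hT x
      refine (injective_mfderiv_iff_chartDeriv hm1 p hxp).2 ?_
      show Injective (fderivWithin ℝ (m ∘ (chartAt (EuclideanSpace ℝ (Fin k)) p).symm)
        (chartAt (EuclideanSpace ℝ (Fin k)) p).target (chartAt (EuclideanSpace ℝ (Fin k)) p x))
      refine (injective_iff_map_eq_zero _).2 fun w' hw' => ?_
      by_contra hne
      have hker := chartReadDeriv_kernel hG1 hβ1 hj hjimm Λ p hxp hx hne hw'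
      exact hΛ₂ ⟨p, hp, x, hxp, w', hker.1, hker.2⟩
    have e1 : mfderiv (𝓡 k) 𝓘(ℝ, E) (c.move g β P) x = mfderiv (𝓡 k) 𝓘(ℝ, E) (c.1.symm ∘ m) x :=
      (hmove_eq x hxs).mfderiv_eq
    rw [e1]
    refine (injective_iff_map_eq_zero _).2 fun v hv => ?_
    have hv' : mfderiv 𝓘(ℝ, E) 𝓘(ℝ, E) c.1.symm (m x) (mfderiv (𝓡 k) 𝓘(ℝ, E) m x v) = 0 :=
      (mfderiv_comp_apply x (hχd (m x)) (hmd x) v).symm.trans hv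
    have h1 : mfderiv (𝓡 k) 𝓘(ℝ, E) m x v = 0 :=
      (injective_iff_map_eq_zero _).1 (c.injective_mfderiv_symm (m x)) _ hv'
    exact (injective_iff_map_eq_zero _).1 hinjm v h1
  -- ### assembly
  refine ⟨P, ?_, ?_, ?_, ?_⟩
  · rw [hP]; exact c.contMDiff_move hg hβ hsupp (contMDiff_columnPert hj Λ)
  · rintro b hb
    by_cases hβb : β b = 0
    · have hbB : b ∈ B := hb.resolve_right (by simpa using hβb)
      rw [K3 b hβb]
      exact hBi b hbB
    · exact K2 b hβb
  · rintro b hb y hy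
    by_contra hyb
    obtain ⟨hβy, hβb⟩ := K1 y b hyb hy
    have hbB : b ∈ B := hb.resolve_right (by simpa using hβb)
    rw [FullChart.move_of_eq_zero hβy, FullChart.move_of_eq_zero hβb] at hy
    exact hyb (hBs b hbB y hy)
  · exact hδP P hΛA

end Step

/-! ### Whitney's easy embedding theorem in a homotopy class -/

section Main

variable {E : Type*} [NormedAddCommGroup E] [InnerProductSpace ℝ E] [FiniteDimensional ℝ E]
  {X : Type*} [TopologicalSpace X] [ChartedSpace E X] [IsManifold 𝓘(ℝ, E) ∞ X]
  {k : ℕ} {M : Type*} [TopologicalSpace M] [ChartedSpace (EuclideanSpace ℝ (Fin k)) M]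
  [IsManifold (𝓡 k) ∞ M] [SecondCountableTopology M] [CompactSpace M] [T2Space M]

/-- **Whitney's easy embedding theorem in a homotopy class, smooth case** (Whitney 1936, §II
Thm. 5; Hirsch 1976, Ch. 2 §2 Thm. 2.13 with Ch. 3 §2 Thm. 2.5; Milnor 1965, Lemma 6.12; Kosinski
1993, II (3.2) / IV (2.4)): a `C^∞` map of a compact Hausdorff `k`-manifold into a manifold `X`
charted on a finite-dimensional inner product space `E` with `2k < dim E` is homotopic to an
injective `C^∞` immersion (finitely many generic chart moves `FullChart.exists_move_injImm` over
a cover of `M` by the sets `{βᵢ ≠ 0}` of bumps supported in preimages of full charts, the chart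
conditions of the later moves carried along as constraints). [cite: HirschDT1976, Ch. 2 §2 Thm. 2.13] -/
theorem exists_injective_immersion_homotopic (hk : 2 * k < finrank ℝ E) (f : C(M, X))
    (hf : ContMDiff (𝓡 k) 𝓘(ℝ, E) ∞ f) :
    ∃ g : C(M, X), ContMDiff (𝓡 k) 𝓘(ℝ, E) ∞ g ∧ Injective g ∧
      (∀ x, Injective (mfderiv (𝓡 k) 𝓘(ℝ, E) g x)) ∧ f.Homotopic g := by
  classical
  -- ### full charts and nonnegative bumps
  have hdata : ∀ x : M, ∃ (c : FullChart E X) (β : C^∞⟮𝓡 k, M; 𝓘(ℝ), ℝ⟯),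
      (β : M → ℝ) x ≠ 0 ∧ (∀ y, 0 ≤ (β : M → ℝ) y) ∧ tsupport β ⊆ f ⁻¹' c.1.source := by
    intro x
    obtain ⟨c, hxc⟩ := exists_fullChart (E := E) (f x)
    have hWo : IsOpen (f ⁻¹' c.1.source) := c.1.open_source.preimage f.continuous
    obtain ⟨K, hKc, hxK, hKW⟩ := exists_compact_between isCompact_singleton hWo
      (singleton_subset_iff.2 hxc)
    obtain ⟨L, hLc, hKL, hLW⟩ := exists_compact_between hKc hWo hKW
    obtain ⟨β, hβ1, hβ0, hβ01⟩ := exists_contMDiffMap_one_nhds_of_subset_interior (𝓡 k)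
      hKc.isClosed hKL (n := (⊤ : ℕ∞))
    refine ⟨c, β, ?_, fun y => (hβ01 y).1, ?_⟩
    · have : (β : M → ℝ) x = 1 := hβ1.self_of_nhdsSet x (interior_subset (hxK rfl))
      rw [this]; exact one_ne_zero
    · refine (closure_minimal (fun y hy => ?_) hLc.isClosed).trans hLW
      by_contra h
      exact hy (hβ0 y h)
  choose c β hβx hβ0 hβs using hdata
  obtain ⟨t, -, htK⟩ := isCompact_univ.elim_nhds_subcover (fun x => {y | (β x : M → ℝ) y ≠ 0})
    fun x _ => (isOpen_ne_fun (β x).contMDiff.continuous continuous_const).mem_nhds (hβx x)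
  -- ### induction over the pieces
  have key : ∀ S : Finset M, S ⊆ t → ∃ g : C(M, X), ContMDiff (𝓡 k) 𝓘(ℝ, E) ∞ g ∧ f.Homotopic g ∧
      (∀ b ∈ ⋃ x ∈ S, {y | (β x : M → ℝ) y ≠ 0}, Injective (mfderiv (𝓡 k) 𝓘(ℝ, E) g b)) ∧
      (∀ b ∈ ⋃ x ∈ S, {y | (β x : M → ℝ) y ≠ 0}, ∀ y, g y = g b → y = b) ∧
        ∀ x : (t : Set M), MapsTo g (tsupport (β x)) (c x).1.source := by
    intro S
    induction S using Finset.induction_on with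
    | empty =>
      intro _
      exact ⟨f, hf, ContinuousMap.Homotopic.refl f, by simp, by simp, fun x y hy => hβs x hy⟩
    | insert a S haS ih =>
      intro hS
      obtain ⟨g, hg, hfg, hBi, hBs, hmaps⟩ := ih ((Finset.subset_insert a S).trans hS)
      have hat : a ∈ t := hS (Finset.mem_insert_self a S)
      have hsupp : tsupport (β a) ⊆ g ⁻¹' (c a).1.source := hmaps ⟨a, hat⟩
      obtain ⟨P, hg', hBi', hBs', hmaps'⟩ := (c a).exists_move_injImm hk hg (β a).contMDiff
        (hβ0 a) hsupp hBi hBs (ι := (t : Set M)) (C := fun x => tsupport (β x))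
        (V := fun x => (c x).1.source) (fun x => (isClosed_tsupport _).isCompact)
        (fun x => (c x).1.open_source) hmaps
      have hunion : (⋃ x ∈ insert a S, {y | (β x : M → ℝ) y ≠ 0}) =
          (⋃ x ∈ S, {y | (β x : M → ℝ) y ≠ 0}) ∪ {y | (β a : M → ℝ) y ≠ 0} := by
        rw [Finset.set_biUnion_insert, union_comm]
      refine ⟨(c a).moveFamily g.continuous (β a).contMDiff.continuous hsupp P, hg',
        hfg.trans ((c a).homotopic_move g.continuous (β a).contMDiff.continuous hsupp P),
        ?_, ?_, hmaps'⟩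
      · intro b hb
        rw [hunion] at hb
        exact hBi' b hb
      · intro b hb
        rw [hunion] at hb
        exact hBs' b hb
  obtain ⟨g, hg, hfg, hBi, hBs, -⟩ := key t Finset.Subset.rfl
  have hcov : ∀ b : M, b ∈ ⋃ x ∈ t, {y | (β x : M → ℝ) y ≠ 0} := fun b => htK (mem_univ b)
  exact ⟨g, hg, fun y b h => hBs b (hcov b) y h, fun b => hBi b (hcov b), hfg⟩

/-- **Whitney's easy embedding theorem in a homotopy class** (Whitney 1936, §II Thm. 5; Hirsch
1976, Ch. 2 §2 Thm. 2.13; Milnor 1965, Lemmas 6.11–6.12; Kosinski 1993, II (3.2), IV (2.4)):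
every CONTINUOUS map of a compact Hausdorff `k`-manifold into a manifold `X` charted on a
finite-dimensional inner product space `E` with `2k < dim E` is homotopic to an injective `C^∞`
immersion — an embedding, `M` being compact (smooth it by `exists_contMDiff_homotopic_of_chartMoves`,
then `exists_injective_immersion_homotopic`). [cite: HirschDT1976, Ch. 2 §2 Thm. 2.13] -/
theorem exists_injective_immersion_homotopic_of_continuous (hk : 2 * k < finrank ℝ E)
    (f : C(M, X)) :
    ∃ g : C(M, X), ContMDiff (𝓡 k) 𝓘(ℝ, E) ∞ g ∧ Injective g ∧
      (∀ x, Injective (mfderiv (𝓡 k) 𝓘(ℝ, E) g x)) ∧ f.Homotopic g := by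
  obtain ⟨g₁, hg₁, hfg₁⟩ := exists_contMDiff_homotopic_of_chartMoves (IM := 𝓡 k) (E := E) f
  obtain ⟨g, hg, hinj, himm, hg₁g⟩ := exists_injective_immersion_homotopic hk g₁ hg₁
  exact ⟨g, hg, hinj, himm, hfg₁.trans hg₁g⟩

end Main

end Literature.Topology.FourManifolds
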